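import Summits.KontsevichZagierPeriods.KontsevichZagierPeriods.Theorems.RootDecompQuadraticDescentZ7ComposeP4

/-! # `RootDecompQuadraticDescentZ7ComposeP5` — part 5/5 of the mechanical ≤400-line split of `Z7Compose.lean` (sha256 65b37838cbe1d1d8…)
Source: decomp-kz lens-6 g11 `Z7Compose.lean` v2 (HOME/decomp-kz-lens-6/g11/, sha256 65b37838…; critic g5-39/g5-47/g5-52 CLEARED, writer A2.4: land Z7Compose v2 + RayAffineRational --supports 28994): K26a / Zagier's Z₇ decided inside the ℚ-rational weight-2 box of crux 28994 — z7_pair: ∃ r r' ℚ-rational with the same integrand 1/(2v(1+τ²)), [r] ≡ 6[T(u)]+6[T(ū²)]+2[T(u³)]+7[T(ζ₇³)], [r'] ≡ 7[T(ζ₇)]+7[T(ζ₇²)], r.value = r'.value, [r] − [r'] ∈ KZ.relations, over five binders = verbatim tree-theorem types; landed by census-1 g9.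
Split by census-1 g9 `gen/splitlean.py`: scopes re-opened with their `open`/`variable`/`set_option` context; mathematics and declaration order unchanged. -/

noncomputable section
open scoped BigOperators ComplexConjugate
open Set
open Literature.NumberTheory.Transcendental
namespace Summit.KontsevichZagierPeriods.RootDecompQuadraticDescent.Z7Compose
section PairMain
open MeasureTheory MvPolynomial
open Literature.ModelTheory.ExponentialFields (IsSemialgebraic)

/-- **`z7_pair` (NODE g11 ADDENDUM 2: K26a as a literal, decided instance of `DescentTwoQ`'s conclusion).**
Under the five binders of `z7_dimTwo` (verbatim tree / g11 theorems) there are two `ℚ`-RATIONAL TWO-DIMENSIONAL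
representations `r`, `r'`, both with the integrand `1/(2v(1+τ²))` on their domains, such that
`[r] ≡ 6[T(u)] + 6[T(ū²)] + 2[T(u³)] + 7[T(ζ₇³)]` and `[r'] ≡ 7[T(ζ₇)] + 7[T(ζ₇²)]` modulo `KZ.relations`
(`T(z) = KZ.idealTetrahedronRep z`), hence `r.value = r'.value` (Zagier's `Z₇`: `6D(u)+6D(ū²)+2D(u³)+7D(ζ₇³) =
7D(ζ₇)+7D(ζ₇²)`) AND `[r] − [r'] ∈ KZ.relations`. [cite: Zagier1986, (5)=(6)] [cite: KontsevichZagier2001, §1.2] -/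
theorem z7_pair
    (hE : ∀ (T : ℂ → Set (Fin 3 → ℝ)), (∀ z, T z = {p | 0 < p 1 ∧ z.re * p 1 < z.im * p 0 ∧
      z.im * (p 0 - 1) < (z.re - 1) * p 1 ∧ 0 < p 2 ∧
      0 < z.im * (p 0 ^ 2 + p 1 ^ 2 + p 2 ^ 2 - p 0) + (z.re - Complex.normSq z) * p 1}) →
      ∀ (ρ : ℂ → KZ.IntegralRep 3), (∀ z, IsAlgebraic ℚ z → 0 < z.im →
      (ρ z).domain = T z ∧ Set.EqOn (ρ z).integrand (fun p => 1 / p 2 ^ 3) (T z)) →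
      ∀ (k : ℕ) (z : Fin k → ℂ) (n : Fin k → ℤ), (∀ i, 0 < (z i).im) →
      (∑ i, n i • FreeAbelianGroup.of (z i)) ∈ AddSubgroup.closure dilogRelators →
      (∑ i, n i • KZ.of (ρ (z i))) ∈ KZ.relations)
    (hH : ∀ (T : ℂ → Set (Fin 3 → ℝ)), (∀ z, T z = {p | 0 < p 1 ∧ z.re * p 1 < z.im * p 0 ∧
      z.im * (p 0 - 1) < (z.re - 1) * p 1 ∧ 0 < p 2 ∧
      0 < z.im * (p 0 ^ 2 + p 1 ^ 2 + p 2 ^ 2 - p 0) + (z.re - Complex.normSq z) * p 1}) →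
      ∀ (ρ : ℂ → KZ.IntegralRep 3), (∀ z, IsAlgebraic ℚ z → 0 < z.im →
      (ρ z).domain = T z ∧ Set.EqOn (ρ z).integrand (fun p => 1 / p 2 ^ 3) (T z)) →
      ((7 : ℤ) • KZ.of (ρ (Complex.exp (2 * Real.pi * Complex.I / 7))) +
      (7 : ℤ) • KZ.of (ρ (Complex.exp (2 * Real.pi * Complex.I / 7) ^ 2)) -
      (7 : ℤ) • KZ.of (ρ (Complex.exp (2 * Real.pi * Complex.I / 7) ^ 3)) -
      (8 : ℤ) • KZ.of (ρ ((1 + (Real.sqrt 7 : ℂ) * Complex.I) / 2)) -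
      (4 : ℤ) • KZ.of (ρ ((-1 + (Real.sqrt 7 : ℂ) * Complex.I) / 4))) ∈ KZ.relations)
    (hM : ∀ (z : ℂ) (hz : IsAlgebraic ℚ z) (him : 0 < z.im) (s : KZ.IntegralRep 2),
      s.domain = rayDom z.re z.im → EqOn s.integrand (rayInt z.re z.im) s.domain →
      KZ.Equivalent (KZ.idealTetrahedronRep z hz him) s)
    (hRex : ∀ (a b : ℝ), IsAlgebraic ℚ a → IsAlgebraic ℚ b →
      ∃ s : KZ.IntegralRep 2, s.domain = rayDom a b ∧ EqOn s.integrand (rayInt a b) s.domain)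
    (hA : ∀ (a b : ℝ), IsAlgebraic ℚ a → IsAlgebraic ℚ b → 0 < b → a ^ 2 + b ^ 2 ≤ 1 →
      ∀ r : KZ.IntegralRep 2, r.domain = rayDom a b → EqOn r.integrand (rayInt a b) r.domain →
      ∃ R : KZ.IntegralRep 2, R.IsRational ∧ R.domain = affDomain a b ∧
      EqOn R.integrand affIntegrand R.domain ∧ KZ.Equivalent r R) :
    ∃ r r' : KZ.IntegralRep 2, r.IsRational ∧ r'.IsRational ∧
      EqOn r.integrand (fun w => 1 / (2 * w 1 * (1 + w 0 ^ 2))) r.domain ∧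
      EqOn r'.integrand (fun w => 1 / (2 * w 1 * (1 + w 0 ^ 2))) r'.domain ∧
      (∀ (h₀ : IsAlgebraic ℚ ((-3 + (Real.sqrt 7 : ℂ) * Complex.I) / 4)) (h₀' : 0 < ((-3 + (Real.sqrt 7 : ℂ) * Complex.I) / 4).im) (h₁ : IsAlgebraic ℚ ((1 + 3 * ((Real.sqrt 7 : ℂ) * Complex.I)) / 8)) (h₁' : 0 < ((1 + 3 * ((Real.sqrt 7 : ℂ) * Complex.I)) / 8).im)
        (h₂ : IsAlgebraic ℚ ((9 + 5 * ((Real.sqrt 7 : ℂ) * Complex.I)) / 16)) (h₂' : 0 < ((9 + 5 * ((Real.sqrt 7 : ℂ) * Complex.I)) / 16).im) (h₅ : IsAlgebraic ℚ (Complex.exp (2 * Real.pi * Complex.I / 7) ^ 3)) (h₅' : 0 < (Complex.exp (2 * Real.pi * Complex.I / 7) ^ 3).im),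
        KZ.of r - ((6 : ℤ) • KZ.of (KZ.idealTetrahedronRep ((-3 + (Real.sqrt 7 : ℂ) * Complex.I) / 4) h₀ h₀') +
          (6 : ℤ) • KZ.of (KZ.idealTetrahedronRep ((1 + 3 * ((Real.sqrt 7 : ℂ) * Complex.I)) / 8) h₁ h₁') +
          (2 : ℤ) • KZ.of (KZ.idealTetrahedronRep ((9 + 5 * ((Real.sqrt 7 : ℂ) * Complex.I)) / 16) h₂ h₂') +
          (7 : ℤ) • KZ.of (KZ.idealTetrahedronRep (Complex.exp (2 * Real.pi * Complex.I / 7) ^ 3) h₅ h₅')) ∈ KZ.relations) ∧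
      (∀ (h₃ : IsAlgebraic ℚ (Complex.exp (2 * Real.pi * Complex.I / 7))) (h₃' : 0 < (Complex.exp (2 * Real.pi * Complex.I / 7)).im) (h₄ : IsAlgebraic ℚ (Complex.exp (2 * Real.pi * Complex.I / 7) ^ 2)) (h₄' : 0 < (Complex.exp (2 * Real.pi * Complex.I / 7) ^ 2).im),
        KZ.of r' - ((7 : ℤ) • KZ.of (KZ.idealTetrahedronRep (Complex.exp (2 * Real.pi * Complex.I / 7)) h₃ h₃') +
          (7 : ℤ) • KZ.of (KZ.idealTetrahedronRep (Complex.exp (2 * Real.pi * Complex.I / 7) ^ 2) h₄ h₄')) ∈ KZ.relations) ∧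
      r.value = r'.value ∧ KZ.of r - KZ.of r' ∈ KZ.relations := by
  classical
  -- the standard tetrahedral family (as in `z7_dimTwo`)
  set T : ℂ → Set (Fin 3 → ℝ) := fun z => idealTetrahedron z with hTdef
  have hT : ∀ z, T z = {p | 0 < p 1 ∧ z.re * p 1 < z.im * p 0 ∧
      z.im * (p 0 - 1) < (z.re - 1) * p 1 ∧ 0 < p 2 ∧
      0 < z.im * (p 0 ^ 2 + p 1 ^ 2 + p 2 ^ 2 - p 0) + (z.re - Complex.normSq z) * p 1} := fun z => rfl
  set ρ : ℂ → KZ.IntegralRep 3 := fun z =>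
    if h : IsAlgebraic ℚ z ∧ 0 < z.im then KZ.idealTetrahedronRep z h.1 h.2 else KZ.IntegralRep.empty 3
    with hρdef
  have hρeq : ∀ z (hz : IsAlgebraic ℚ z) (him : 0 < z.im), ρ z = KZ.idealTetrahedronRep z hz him := by
    intro z hz him
    simp only [hρdef, dif_pos (show IsAlgebraic ℚ z ∧ 0 < z.im from ⟨hz, him⟩)]
  have hρ : ∀ z, IsAlgebraic ℚ z → 0 < z.im →
      (ρ z).domain = T z ∧ Set.EqOn (ρ z).integrand (fun p => 1 / p 2 ^ 3) (T z) := by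
    intro z hz him
    rw [hρeq z hz him]
    exact ⟨rfl, fun _ _ => rfl⟩
  have hZ := z7_tetra hE hH T hT ρ hρ
  -- the unit-circle pieces, with their windows `Cz z τ : 0 < Re z + Im z·τ < 1`
  obtain ⟨Cz, hCz⟩ : ∃ Cz : ℂ → ℝ → Prop,
      Cz = fun z t => 0 < z.re + z.im * t ∧ z.re + z.im * t < 1 := ⟨_, rfl⟩
  have step : ∀ z (hz : IsAlgebraic ℚ z) (him : 0 < z.im), z.re ^ 2 + z.im ^ 2 = 1 →
      ∃ R : KZ.IntegralRep 2,
        (∀ w ∈ R.domain, Cz z (w 0) ∧ 0 < w 1 ∧ w 1 < 1) ∧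
        EqOn R.integrand gInt R.domain ∧
        KZ.of (KZ.idealTetrahedronRep z hz him) - KZ.of R ∈ KZ.relations := by
    intro z hz him hN
    obtain ⟨hre, himA⟩ := isAlgebraic_re_im hz
    obtain ⟨s, hs, hsi⟩ := hRex z.re z.im hre himA
    have h1 : KZ.Equivalent (KZ.idealTetrahedronRep z hz him) s := hM z hz him s hs hsi
    obtain ⟨R, -, hRd, hRi, h2⟩ := hA z.re z.im hre himA him hN.le s hs hsi
    refine ⟨R, fun w hw => ⟨?_, (affDomain_facts hN (hRd ▸ hw)).2⟩, fun w hw => ?_, h1.trans h2⟩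
    · rw [hCz]
      exact (affDomain_facts hN (hRd ▸ hw)).1
    · rw [hRi hw]
      exact affIntegrand_eq_gInt hN (hRd ▸ hw)
  -- the six shapes
  obtain ⟨⟨hr0, hi0⟩, ⟨hr1, hi1⟩, ⟨hr2, hi2⟩⟩ := quad_re_im
  have h7 : Real.sqrt 7 ^ 2 = 7 := Real.sq_sqrt (by norm_num)
  have hz0 : IsAlgebraic ℚ ((-3 + (Real.sqrt 7 : ℂ) * Complex.I) / 4) := by
    convert isAlgebraic_lin (-3 / 4) (1 / 4) using 1; push_cast; ring
  have hz1 : IsAlgebraic ℚ ((1 + 3 * ((Real.sqrt 7 : ℂ) * Complex.I)) / 8) := by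
    convert isAlgebraic_lin (1 / 8) (3 / 8) using 1; push_cast; ring
  have hz2 : IsAlgebraic ℚ ((9 + 5 * ((Real.sqrt 7 : ℂ) * Complex.I)) / 16) := by
    convert isAlgebraic_lin (9 / 16) (5 / 16) using 1; push_cast; ring
  have him0 : 0 < ((-3 + (Real.sqrt 7 : ℂ) * Complex.I) / 4).im := by rw [hi0]; positivity
  have him1 : 0 < ((1 + 3 * ((Real.sqrt 7 : ℂ) * Complex.I)) / 8).im := by rw [hi1]; positivity
  have him2 : 0 < ((9 + 5 * ((Real.sqrt 7 : ℂ) * Complex.I)) / 16).im := by rw [hi2]; positivity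
  have hn0 : ((-3 + (Real.sqrt 7 : ℂ) * Complex.I) / 4).re ^ 2 + ((-3 + (Real.sqrt 7 : ℂ) * Complex.I) / 4).im ^ 2 = 1 := by rw [hr0, hi0]; nlinarith [h7]
  have hn1 : ((1 + 3 * ((Real.sqrt 7 : ℂ) * Complex.I)) / 8).re ^ 2 + ((1 + 3 * ((Real.sqrt 7 : ℂ) * Complex.I)) / 8).im ^ 2 = 1 := by rw [hr1, hi1]; nlinarith [h7]
  have hn2 : ((9 + 5 * ((Real.sqrt 7 : ℂ) * Complex.I)) / 16).re ^ 2 + ((9 + 5 * ((Real.sqrt 7 : ℂ) * Complex.I)) / 16).im ^ 2 = 1 := by rw [hr2, hi2]; nlinarith [h7]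
  have hz3 := zeta_pow_isAlgebraic 1
  have hz4 := zeta_pow_isAlgebraic 2
  have hz5 := zeta_pow_isAlgebraic 3
  have him3 := zeta_pow_im_pos 1 le_rfl (by norm_num)
  have him4 := zeta_pow_im_pos 2 (by norm_num) (by norm_num)
  have him5 := zeta_pow_im_pos 3 (by norm_num) le_rfl
  rw [pow_one] at hz3 him3
  have hn3 : (Complex.exp (2 * Real.pi * Complex.I / 7)).re ^ 2 + (Complex.exp (2 * Real.pi * Complex.I / 7)).im ^ 2 = 1 := by
    obtain ⟨hre, him⟩ := zeta_pow_re_im 1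
    rw [pow_one] at hre him
    rw [hre, him, Real.cos_sq_add_sin_sq]
  have hn4 : (Complex.exp (2 * Real.pi * Complex.I / 7) ^ 2).re ^ 2 + (Complex.exp (2 * Real.pi * Complex.I / 7) ^ 2).im ^ 2 = 1 := by
    obtain ⟨hre, him⟩ := zeta_pow_re_im 2
    rw [hre, him, Real.cos_sq_add_sin_sq]
  have hn5 : (Complex.exp (2 * Real.pi * Complex.I / 7) ^ 3).re ^ 2 + (Complex.exp (2 * Real.pi * Complex.I / 7) ^ 3).im ^ 2 = 1 := by
    obtain ⟨hre, him⟩ := zeta_pow_re_im 3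
    rw [hre, him, Real.cos_sq_add_sin_sq]
  obtain ⟨R0, hR0d, hR0i, hd0⟩ := step _ hz0 him0 hn0
  obtain ⟨R1, hR1d, hR1i, hd1⟩ := step _ hz1 him1 hn1
  obtain ⟨R2, hR2d, hR2i, hd2⟩ := step _ hz2 him2 hn2
  obtain ⟨R3, hR3d, hR3i, hd3⟩ := step _ hz3 him3 hn3
  obtain ⟨R4, hR4d, hR4i, hd4⟩ := step _ hz4 him4 hn4
  obtain ⟨R5, hR5d, hR5i, hd5⟩ := step _ hz5 him5 hn5
  -- slots: A = {u (×6), ū² (×6)}, B = {u³ (×2), ζ³ (×7)};  A' = {ζ (×7)}, B' = {ζ² (×7)}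
  obtain ⟨P0, hP0d, hP0i, hP0⟩ := slotA (Cz _) R0 hR0d hR0i 6 (by norm_num)
  obtain ⟨P1, hP1d, hP1i, hP1⟩ := slotA (Cz _) R1 hR1d hR1i 6 (by norm_num)
  obtain ⟨P2, hP2d, hP2i, hP2⟩ := slotB (Cz _) R2 hR2d hR2i 2 (by norm_num)
  obtain ⟨P5, hP5d, hP5i, hP5⟩ := slotB (Cz _) R5 hR5d hR5i 7 (by norm_num)
  obtain ⟨P3, hP3d, hP3i, hP3⟩ := slotA (Cz _) R3 hR3d hR3i 7 (by norm_num)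
  obtain ⟨P4, hP4d, hP4i, hP4⟩ := slotB (Cz _) R4 hR4d hR4i 7 (by norm_num)
  -- disjointness
  obtain ⟨hr5, hi5⟩ := zeta3_re_im
  have d01 : Disjoint P0.domain P1.domain := by
    refine Set.disjoint_left.2 fun w hw0 hw1 => ?_
    obtain ⟨ha, -⟩ := hP0d w hw0
    obtain ⟨hb, -⟩ := hP1d w hw1
    simp only [hCz] at ha hb
    rw [hr0, hi0] at ha
    rw [hr1, hi1] at hb
    exact sepA ha.1 hb.2
  have d25 : Disjoint P2.domain P5.domain := by
    refine Set.disjoint_left.2 fun w hw2 hw5 => ?_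
    obtain ⟨ha, -⟩ := hP2d w hw2
    obtain ⟨hb, -⟩ := hP5d w hw5
    simp only [hCz] at ha hb
    rw [hr2, hi2] at ha
    rw [hr5, hi5] at hb
    exact sepB ha.2 hb.1
  obtain ⟨SA, hSAd, hSAi, hSA⟩ := glue_rep P0 P1 d01 hP0i hP1i
  obtain ⟨SB, hSBd, hSBi, hSB⟩ := glue_rep P2 P5 d25 hP2i hP5i
  have dAB : Disjoint SA.domain SB.domain := by
    refine Set.disjoint_left.2 fun w hwA hwB => ?_
    rw [hSAd] at hwA
    rw [hSBd] at hwB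
    have hlt : w 1 < 1 := by
      rcases hwA with h | h
      · exact (hP0d w h).2.2
      · exact (hP1d w h).2.2
    have hgt : 1 < w 1 := by
      rcases hwB with h | h
      · exact (hP2d w h).2
      · exact (hP5d w h).2
    exact lt_irrefl _ (hlt.trans hgt)
  have d34 : Disjoint P3.domain P4.domain := by
    refine Set.disjoint_left.2 fun w hw3 hw4 => ?_
    exact lt_irrefl _ (((hP3d w hw3).2.2).trans (hP4d w hw4).2)
  obtain ⟨r, hrd, hri, hr⟩ := glue_rep SA SB dAB hSAi hSBi
  obtain ⟨r', hr'd, hr'i, hr'⟩ := glue_rep P3 P4 d34 hP3i hP4i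
  -- non-vanishing of `v` on the glued domains
  have hrne : ∀ w ∈ r.domain, w 1 ≠ 0 := by
    intro w hw
    rw [hrd] at hw
    rcases hw with hw | hw
    · rw [hSAd] at hw
      rcases hw with h | h
      · exact (hP0d w h).2.1.ne'
      · exact (hP1d w h).2.1.ne'
    · rw [hSBd] at hw
      rcases hw with h | h
      · exact (zero_lt_one.trans (hP2d w h).2).ne'
      · exact (zero_lt_one.trans (hP5d w h).2).ne'
  have hr'ne : ∀ w ∈ r'.domain, w 1 ≠ 0 := by
    intro w hw
    rw [hr'd] at hw
    rcases hw with h | h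
    · exact (hP3d w h).2.1.ne'
    · exact (zero_lt_one.trans (hP4d w h).2).ne'
  -- the two side relations
  have hL : KZ.of r - ((6 : ℤ) • KZ.of (KZ.idealTetrahedronRep _ hz0 him0) +
      (6 : ℤ) • KZ.of (KZ.idealTetrahedronRep _ hz1 him1) +
      (2 : ℤ) • KZ.of (KZ.idealTetrahedronRep _ hz2 him2) +
      (7 : ℤ) • KZ.of (KZ.idealTetrahedronRep _ hz5 him5)) ∈ KZ.relations := by
    have e : KZ.of r - ((6 : ℤ) • KZ.of (KZ.idealTetrahedronRep _ hz0 him0) +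
        (6 : ℤ) • KZ.of (KZ.idealTetrahedronRep _ hz1 him1) +
        (2 : ℤ) • KZ.of (KZ.idealTetrahedronRep _ hz2 him2) +
        (7 : ℤ) • KZ.of (KZ.idealTetrahedronRep _ hz5 him5)) =
      (KZ.of r - KZ.of SA - KZ.of SB) + (KZ.of SA - KZ.of P0 - KZ.of P1) +
        (KZ.of SB - KZ.of P2 - KZ.of P5) -
        (((6 : ℤ) • KZ.of R0 - KZ.of P0) + ((6 : ℤ) • KZ.of R1 - KZ.of P1) +
          ((2 : ℤ) • KZ.of R2 - KZ.of P2) + ((7 : ℤ) • KZ.of R5 - KZ.of P5)) -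
        ((6 : ℤ) • (KZ.of (KZ.idealTetrahedronRep _ hz0 him0) - KZ.of R0) +
          (6 : ℤ) • (KZ.of (KZ.idealTetrahedronRep _ hz1 him1) - KZ.of R1) +
          (2 : ℤ) • (KZ.of (KZ.idealTetrahedronRep _ hz2 him2) - KZ.of R2) +
          (7 : ℤ) • (KZ.of (KZ.idealTetrahedronRep _ hz5 him5) - KZ.of R5)) := by
      abel
    rw [e]
    refine KZ.relations.sub_mem (KZ.relations.sub_mem
      (KZ.relations.add_mem (KZ.relations.add_mem hr hSA) hSB)
      (KZ.relations.add_mem (KZ.relations.add_mem (KZ.relations.add_mem hP0 hP1) hP2) hP5)) ?_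
    exact KZ.relations.add_mem (KZ.relations.add_mem (KZ.relations.add_mem
      (KZ.relations.zsmul_mem hd0 6) (KZ.relations.zsmul_mem hd1 6)) (KZ.relations.zsmul_mem hd2 2))
      (KZ.relations.zsmul_mem hd5 7)
  have hR : KZ.of r' - ((7 : ℤ) • KZ.of (KZ.idealTetrahedronRep _ hz3 him3) +
      (7 : ℤ) • KZ.of (KZ.idealTetrahedronRep _ hz4 him4)) ∈ KZ.relations := by
    have e : KZ.of r' - ((7 : ℤ) • KZ.of (KZ.idealTetrahedronRep _ hz3 him3) +
        (7 : ℤ) • KZ.of (KZ.idealTetrahedronRep _ hz4 him4)) =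
      (KZ.of r' - KZ.of P3 - KZ.of P4) -
        (((7 : ℤ) • KZ.of R3 - KZ.of P3) + ((7 : ℤ) • KZ.of R4 - KZ.of P4)) -
        ((7 : ℤ) • (KZ.of (KZ.idealTetrahedronRep _ hz3 him3) - KZ.of R3) +
          (7 : ℤ) • (KZ.of (KZ.idealTetrahedronRep _ hz4 him4) - KZ.of R4)) := by
      abel
    rw [e]
    exact KZ.relations.sub_mem (KZ.relations.sub_mem hr' (KZ.relations.add_mem hP3 hP4))
      (KZ.relations.add_mem (KZ.relations.zsmul_mem hd3 7) (KZ.relations.zsmul_mem hd4 7))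
  -- `Z₇` joins the two sides
  have hZ' : ((6 : ℤ) • KZ.of (KZ.idealTetrahedronRep _ hz0 him0) +
      (6 : ℤ) • KZ.of (KZ.idealTetrahedronRep _ hz1 him1) +
      (2 : ℤ) • KZ.of (KZ.idealTetrahedronRep _ hz2 him2) +
      (7 : ℤ) • KZ.of (KZ.idealTetrahedronRep _ hz5 him5)) -
      ((7 : ℤ) • KZ.of (KZ.idealTetrahedronRep _ hz3 him3) +
        (7 : ℤ) • KZ.of (KZ.idealTetrahedronRep _ hz4 him4)) ∈ KZ.relations := by
    rw [← hρeq _ hz0 him0, ← hρeq _ hz1 him1, ← hρeq _ hz2 him2, ← hρeq _ hz3 him3,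
      ← hρeq _ hz4 him4, ← hρeq _ hz5 him5]
    have e : ((6 : ℤ) • KZ.of (ρ ((-3 + (Real.sqrt 7 : ℂ) * Complex.I) / 4)) + (6 : ℤ) • KZ.of (ρ ((1 + 3 * ((Real.sqrt 7 : ℂ) * Complex.I)) / 8)) + (2 : ℤ) • KZ.of (ρ ((9 + 5 * ((Real.sqrt 7 : ℂ) * Complex.I)) / 16)) +
        (7 : ℤ) • KZ.of (ρ (Complex.exp (2 * Real.pi * Complex.I / 7) ^ 3))) - ((7 : ℤ) • KZ.of (ρ (Complex.exp (2 * Real.pi * Complex.I / 7))) + (7 : ℤ) • KZ.of (ρ (Complex.exp (2 * Real.pi * Complex.I / 7) ^ 2))) =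
      (6 : ℤ) • KZ.of (ρ ((-3 + (Real.sqrt 7 : ℂ) * Complex.I) / 4)) + (6 : ℤ) • KZ.of (ρ ((1 + 3 * ((Real.sqrt 7 : ℂ) * Complex.I)) / 8)) + (2 : ℤ) • KZ.of (ρ ((9 + 5 * ((Real.sqrt 7 : ℂ) * Complex.I)) / 16)) -
        (7 : ℤ) • KZ.of (ρ (Complex.exp (2 * Real.pi * Complex.I / 7))) - (7 : ℤ) • KZ.of (ρ (Complex.exp (2 * Real.pi * Complex.I / 7) ^ 2)) + (7 : ℤ) • KZ.of (ρ (Complex.exp (2 * Real.pi * Complex.I / 7) ^ 3)) := by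
      abel
    rw [e]
    exact hZ
  have hrr' : KZ.of r - KZ.of r' ∈ KZ.relations := by
    have e : KZ.of r - KZ.of r' =
      (KZ.of r - ((6 : ℤ) • KZ.of (KZ.idealTetrahedronRep _ hz0 him0) +
        (6 : ℤ) • KZ.of (KZ.idealTetrahedronRep _ hz1 him1) +
        (2 : ℤ) • KZ.of (KZ.idealTetrahedronRep _ hz2 him2) +
        (7 : ℤ) • KZ.of (KZ.idealTetrahedronRep _ hz5 him5))) -
      (KZ.of r' - ((7 : ℤ) • KZ.of (KZ.idealTetrahedronRep _ hz3 him3) +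
        (7 : ℤ) • KZ.of (KZ.idealTetrahedronRep _ hz4 him4))) +
      (((6 : ℤ) • KZ.of (KZ.idealTetrahedronRep _ hz0 him0) +
        (6 : ℤ) • KZ.of (KZ.idealTetrahedronRep _ hz1 him1) +
        (2 : ℤ) • KZ.of (KZ.idealTetrahedronRep _ hz2 him2) +
        (7 : ℤ) • KZ.of (KZ.idealTetrahedronRep _ hz5 him5)) -
        ((7 : ℤ) • KZ.of (KZ.idealTetrahedronRep _ hz3 him3) +
          (7 : ℤ) • KZ.of (KZ.idealTetrahedronRep _ hz4 him4))) := by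
      abel
    rw [e]
    exact KZ.relations.add_mem (KZ.relations.sub_mem hL hR) hZ'
  refine ⟨r, r', isRational_of_gInt r hri hrne, isRational_of_gInt r' hr'i hr'ne,
    fun w hw => by rw [hri hw, gInt], fun w hw => by rw [hr'i hw, gInt],
    fun _ _ _ _ _ _ _ _ => hL, fun _ _ _ _ => hR, KZ.Equivalent.value_eq_holds hrr', hrr'⟩

end PairMain

end Summit.KontsevichZagierPeriods.RootDecompQuadraticDescent.Z7Compose

end
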